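import Mathlib
import HarnessLib
import Literature.MathematicalPhysics.QuantumLattice.HubbardDiagonalQuadraticEffAction
import Summits.HubbardSuperconductivity.HubbardSuperconductivity.Theorems.KLProgrammeKLRegimeTwoVolumeFrameMismatchResum
import Summits.HubbardSuperconductivity.HubbardSuperconductivity.Theorems.KLProgrammeKLRegimeVolumeLimitDefs

/-!
# VL child `KLRegimeVolumeLimitV17F2` (stmt-…-20440), last scale: **THE FRAME CHANGE OF THE ONE-SHOT ACTION IS EXACT BELOW TEMPERATURE** —
# at any scale `Λ_n = klScale e₀ n ≤ π/β` (in particular at the VL reading scale `n = nScales β + 1`) the single-scale mismatch covariance VANISHES,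
# `T(K₂) = chain_D + S_m·T(K₁)` and `Σ^{K₂}(k,σ) = D(p_k⃗) − D(p_k⃗)·r + (1 − r)²·Σ^{K₁}(k,σ)` hold EXACTLY, with `‖r‖ ≤ |D(p_k⃗)|·β/π`

Cell gate-hubbard-kl, seat hubbard-kl-k3c4-p2 (g9; technique «Matsubara all-U»: exact covariance / Grassmann identities).  Sequel of
`…TwoVolumeFrameMismatchResum` (p549694).  Notation as there: ONE volume (or cutoff), two frames `K₁`, `K₂`, `D = K₂ ⊖ K₁` (`fsub`), `Ψ_K = uvSymbolCT … K Λ_n`,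
`κ_D(ks) = D(p_k⃗)/(βL²)`, `Ψ̃ = Ψ_{K₂}/(1 + Ψ_{K₂}κ_D)`, `d = Ψ̃ − Ψ_{K₁}`, `T(K) = klEffectiveAction … K e₀ n`, `Z(K)` its undressed scale-`n` partition function,
`m = (1 + Ψ_{K₂}κ_D)⁻¹`, `r(k,σ) = κ_D(k)·Ψ̃(k,σ) = wD/(−iω + e_{K₂} + wD)`.

THE POINT.  p549694 shows `T(K₂) = chain_D + S_m·effAction_{normalCovariance d}(T(K₁))` with `d` SINGLE-SCALE: `d((i,k⃗),σ) = 0` at every `|ω_i| ≥ Λ_n`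
(`mismatchDefect_eq_zero_of_freq_ge`).  Temperature is an infrared cutoff: `π/β ≤ |ω_i|` for every fermionic Matsubara frequency
(`pi_div_le_abs_matsubaraFreq`), and the VL child reads the carriers at the LAST index `n = nScales β + 1`, where `klScale klE0 (nScales β + 1) < π/β`
(`klScale_nScales_succ_lt`).  Hence at the reading scale `d ≡ 0`: the near-identity step is the identity (`effAction_zero_cov`), and the frame change of the
last-scale carrier of ONE volume is PURE ALGEBRA — no covariance response, no interpolating partition functions `Z_t`, no four-leg sup.
* §1 `mismatchDefect_eq_zero_of_scale_le_pi_div`, `normalCovariance_mismatchDefect_eq_zero_of_scale_le_pi_div` (`d ≡ 0`, `normalCovariance d = 0`).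
* §2 partition functions: **`effPartitionFn_frame_eq_prod_mul_of_scale_le_pi_div`** `Z(K₂) = Π_{ks}(1 + Ψ_{K₂}κ_D)·Z(K₁)` and
  `isUnit_effPartitionFn_frame_iff_of_scale_le_pi_div` (`Z(K₂)` is a unit iff `Z(K₁)` is — unit-ness is frame-independent below temperature).
* §3 **`klEffectiveAction_frame_eq_chain_add_map_of_scale_le_pi_div`**: `T(K₂) = effAction (normalCovariance Ψ_{K₂}) 𝒩_D + S_m·T(K₁)` EXACTLY.
* §4 the reading: **`klSelfEnergy_frame_eq_dressed_of_scale_le_pi_div`** `Σ^{K₂}(k,σ) = βL²κ_D − βL²κ_D²Ψ̃(k,σ) + (1 − κ_DΨ̃(k,σ))²·Σ^{K₁}(k,σ)`;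
  `norm_frameDressing_le` (`‖κ_D(k)Ψ̃(k,σ)‖ ≤ |D(p_k⃗)|·(β/π)`, ANY scale: `|Im(−iω + e + wD)| = |ω| ≥ π/β`, `0 ≤ w ≤ 1`);
  **`norm_klSelfEnergy_frame_sub_sub_le_of_scale_le_pi_div`**: `‖Σ^{K₂}(k,σ) − Σ^{K₁}(k,σ) − D(p_k⃗)‖ ≤ |D|·(β/π)·(|D| + (2 + |D|·β/π)·‖Σ^{K₁}(k,σ)‖)`.
* §5 the same at the VL reading scale of the KL regime (`e₀ = klE0`, `n = nScales β + 1`, only `0 < β`): `…_lastScale` corollaries.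
CONSEQUENCE for 20440 (door in `…VolumeLimitLastScaleCommonFrameDoor`): leg (ii) of k3c5-p3's triangle door `framedNestedFlowTextV17F2_of_commonFrame_and_mismatch`
(ONE volume `L″`, frames `K_L` vs `K_{L″}`, `|K_{L″}(p) − K_L(p)| ≤ (Σ_m Q.CL β m)/L` by `flowFrames_twoVolume_of_towerV17F2`) is discharged by this algebra, so the
registered stub follows from the COMMON-FRAME two-volume comparison alone; the (A3) induction may run both internal towers at the common frame `K_L`.
Proofs only; no definitions; nothing asserts superconductivity.  References: Feldman–Salmhofer–Trubowitz 1996 §1 (counterterm chain and dressing);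
Benfatto–Giuliani–Mastropietro 2006 §2.3 (2.21)–(2.24), §2.4 (2.38); Salmhofer 1999 §4.2.3 (temperature as infrared cutoff).
-/

noncomputable section

namespace Summit.HubbardSuperconductivity.HubbardSuperconductivity.Theorems.TwoVolumeDefect

set_option linter.dupNamespace false -- summit = problem name (single-conjunct summit), D-0017

open Finset Complex Literature.MathematicalPhysics.QuantumLattice Literature.Probability.LatticeModels GrassmannAlgebra
open Summit.HubbardSuperconductivity.HubbardSuperconductivity.Theorems.KLRegimeSplit
open Summit.HubbardSuperconductivity.HubbardSuperconductivity.Theorems.KLProgrammeLegKernels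
open Summit.HubbardSuperconductivity.HubbardSuperconductivity.Theorems.EngineV8

variable {L M : ℕ} [NeZero L]

/-! ## §1 Below temperature the mismatch covariance vanishes identically -/

section BelowTemperature

variable {β : ℝ} (hβ : 0 < β) (U μ : ℝ) (K₁ K₂ : TrigPolyC4v) (e₀ : ℝ) (n : ℕ)
  (hΛ : 0 < klScale e₀ n) (hΛβ : klScale e₀ n ≤ Real.pi / β)
include hβ hΛ hΛβ

/-- **Below temperature the single-scale mismatch defect vanishes identically**: if `Λ_n ≤ π/β` then `Ψ̃(ks) − Ψ_{K₁}(ks) = 0` at EVERY label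
(`π/β ≤ |ω_i|` for every fermionic frequency, and the defect vanishes at `|ω_i| ≥ Λ_n`). [cite: Salmhofer1999, §4.2.3] -/
theorem mismatchDefect_eq_zero_of_scale_le_pi_div (ks : FreqMomentum L M × Fin 2) :
    uvSymbolCT L M β μ K₂ (klScale e₀ n) ks /
          (1 + uvSymbolCT L M β μ K₂ (klScale e₀ n) ks * (((fsub K₂ K₁).eval (latticeMomentum L ks.1.2) / (β * (L : ℝ) ^ 2) : ℝ) : ℂ)) -
        uvSymbolCT L M β μ K₁ (klScale e₀ n) ks = 0 := by
  obtain ⟨⟨i, kv⟩, σ⟩ := ks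
  exact mismatchDefect_eq_zero_of_freq_ge hβ μ K₁ K₂ (klScale e₀ n) hΛ i kv σ (hΛβ.trans (pi_div_le_abs_matsubaraFreq hβ i))

/-- Hence the resummed symbol IS the frame-`K₁` symbol: `Ψ̃ = Ψ_{K₁}` as functions. [cite: Salmhofer1999, §4.2.3] -/
theorem mismatchResummed_eq_uvSymbolCT_of_scale_le_pi_div :
    (fun ks : FreqMomentum L M × Fin 2 => uvSymbolCT L M β μ K₂ (klScale e₀ n) ks /
        (1 + uvSymbolCT L M β μ K₂ (klScale e₀ n) ks * (((fsub K₂ K₁).eval (latticeMomentum L ks.1.2) / (β * (L : ℝ) ^ 2) : ℝ) : ℂ))) =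
      uvSymbolCT L M β μ K₁ (klScale e₀ n) := by
  funext ks
  exact sub_eq_zero.1 (mismatchDefect_eq_zero_of_scale_le_pi_div hβ μ K₁ K₂ e₀ n hΛ hΛβ ks)

/-- … and the near-identity covariance of p549694 §4 is ZERO: `normalCovariance d = 0`. [cite: Salmhofer1999, §4.2.3] -/
theorem normalCovariance_mismatchDefect_eq_zero_of_scale_le_pi_div :
    normalCovariance L M (fun ks : FreqMomentum L M × Fin 2 =>
        uvSymbolCT L M β μ K₂ (klScale e₀ n) ks /
            (1 + uvSymbolCT L M β μ K₂ (klScale e₀ n) ks * (((fsub K₂ K₁).eval (latticeMomentum L ks.1.2) / (β * (L : ℝ) ^ 2) : ℝ) : ℂ)) -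
          uvSymbolCT L M β μ K₁ (klScale e₀ n) ks) = 0 := by
  have h0 : (fun ks : FreqMomentum L M × Fin 2 =>
      uvSymbolCT L M β μ K₂ (klScale e₀ n) ks /
          (1 + uvSymbolCT L M β μ K₂ (klScale e₀ n) ks * (((fsub K₂ K₁).eval (latticeMomentum L ks.1.2) / (β * (L : ℝ) ^ 2) : ℝ) : ℂ)) -
        uvSymbolCT L M β μ K₁ (klScale e₀ n) ks) = fun _ => 0 := by
    funext ks
    exact mismatchDefect_eq_zero_of_scale_le_pi_div hβ μ K₁ K₂ e₀ n hΛ hΛβ ks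
  rw [h0]
  ext X Y
  rw [normalCovariance_apply, Matrix.zero_apply]
  split_ifs <;> simp

/-! ## §2 Partition functions: unit-ness is frame-independent below temperature -/

/-- **`Z(K₂) = Π_{ks}(1 + Ψ_{K₂}(ks)κ_D(ks)) · Z(K₁)`** below temperature: the partition function factorises through the mismatch vertex
(`effPartitionFn_normalCovariance_add_diagQuadratic`, `effPartitionFn_normalCovariance_diagQuadratic`), and the dressed one is the frame-`K₁` one because
`Ψ̃ = Ψ_{K₁}`. [cite: BenfattoGiulianiMastropietro2006, §2.3 (2.24)] -/
theorem effPartitionFn_frame_eq_prod_mul_of_scale_le_pi_div [NeZero M] :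
    effPartitionFn ℂ (normalCovariance L M (uvSymbolCT L M β μ K₂ (klScale e₀ n)))
        (hubbardInteraction L M β U + counterQuadratic L M β K₂) =
      (∏ ks : FreqMomentum L M × Fin 2, (1 + uvSymbolCT L M β μ K₂ (klScale e₀ n) ks *
          (((fsub K₂ K₁).eval (latticeMomentum L ks.1.2) / (β * (L : ℝ) ^ 2) : ℝ) : ℂ))) *
        effPartitionFn ℂ (normalCovariance L M (uvSymbolCT L M β μ K₁ (klScale e₀ n)))
          (hubbardInteraction L M β U + counterQuadratic L M β K₁) := by
  have hsplit : hubbardInteraction L M β U + counterQuadratic L M β K₂ =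
      (hubbardInteraction L M β U + counterQuadratic L M β K₁) + counterQuadratic L M β (fsub K₂ K₁) := by
    rw [counterQuadratic_fsub]; abel
  have hden : ∀ ks : FreqMomentum L M × Fin 2, 1 + uvSymbolCT L M β μ K₂ (klScale e₀ n) ks *
      (((fsub K₂ K₁).eval (latticeMomentum L ks.1.2) / (β * (L : ℝ) ^ 2) : ℝ) : ℂ) ≠ 0 := fun ks =>
    one_add_uvSymbolCT_mul_ofReal_ne_zero hβ μ K₂ (klScale e₀ n) _ ks
  have hV0 : constPart ℂ (hubbardInteraction L M β U + counterQuadratic L M β K₁) = 0 := by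
    rw [map_add, constPart_hubbardInteraction, constPart_counterQuadratic, add_zero]
  rw [hsplit, effPartitionFn_normalCovariance_add_diagQuadratic (uvSymbolCT L M β μ K₂ (klScale e₀ n))
      (fun ks => (((fsub K₂ K₁).eval (latticeMomentum L ks.1.2) / (β * (L : ℝ) ^ 2) : ℝ) : ℂ)) hden
      (counterQuadratic_eq_sum_smul β (fsub K₂ K₁)) hV0,
    counterQuadratic_eq_sum_smul β (fsub K₂ K₁), effPartitionFn_normalCovariance_diagQuadratic _ _ hden,
    mismatchResummed_eq_uvSymbolCT_of_scale_le_pi_div hβ μ K₁ K₂ e₀ n hΛ hΛβ]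

/-- **Below temperature `Z(K₂)` is a unit iff `Z(K₁)` is** (the product `Π(1 + Ψ_{K₂}κ_D)` never vanishes). [cite: BenfattoGiulianiMastropietro2006, §2.3 (2.24)] -/
theorem isUnit_effPartitionFn_frame_iff_of_scale_le_pi_div [NeZero M] :
    IsUnit (effPartitionFn ℂ (normalCovariance L M (uvSymbolCT L M β μ K₂ (klScale e₀ n)))
        (hubbardInteraction L M β U + counterQuadratic L M β K₂)) ↔
      IsUnit (effPartitionFn ℂ (normalCovariance L M (uvSymbolCT L M β μ K₁ (klScale e₀ n)))
        (hubbardInteraction L M β U + counterQuadratic L M β K₁)) := by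
  have hden : ∀ ks : FreqMomentum L M × Fin 2, 1 + uvSymbolCT L M β μ K₂ (klScale e₀ n) ks *
      (((fsub K₂ K₁).eval (latticeMomentum L ks.1.2) / (β * (L : ℝ) ^ 2) : ℝ) : ℂ) ≠ 0 := fun ks =>
    one_add_uvSymbolCT_mul_ofReal_ne_zero hβ μ K₂ (klScale e₀ n) _ ks
  have hprod : IsUnit (∏ ks : FreqMomentum L M × Fin 2, (1 + uvSymbolCT L M β μ K₂ (klScale e₀ n) ks *
      (((fsub K₂ K₁).eval (latticeMomentum L ks.1.2) / (β * (L : ℝ) ^ 2) : ℝ) : ℂ))) :=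
    isUnit_iff_ne_zero.2 (Finset.prod_ne_zero_iff.2 fun ks _ => hden ks)
  rw [effPartitionFn_frame_eq_prod_mul_of_scale_le_pi_div hβ U μ K₁ K₂ e₀ n hΛ hΛβ, IsUnit.mul_iff]
  exact ⟨fun h => h.2, fun h => ⟨hprod, h⟩⟩

/-! ## §3 The one-shot action: the frame change is EXACT below temperature -/

/-- **`T(K₂) = effAction (normalCovariance Ψ_{K₂}) 𝒩_D + S_m·T(K₁)` EXACTLY below temperature** (`Λ_n ≤ π/β`; frame-`K₁` partition function a unit):
p549694's `klEffectiveAction_eq_chain_add_map_nearIdentity` with `normalCovariance d = 0` and `effAction 0 W = W` (`effAction_zero_cov`); the frame-`K₂`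
partition function is then nonzero by §2.  The first summand is the explicit quadratic chain `Σ_{ks} κ_D/(1 + Ψ_{K₂}κ_D)·ψ̂⁺ψ̂⁻`
(`effAction_normalCovariance_diagQuadratic`). [cite: BenfattoGiulianiMastropietro2006, §2.3 (2.21)–(2.24)] -/
theorem klEffectiveAction_frame_eq_chain_add_map_of_scale_le_pi_div [NeZero M]
    (hZ₁ : IsUnit (effPartitionFn ℂ (normalCovariance L M (uvSymbolCT L M β μ K₁ (klScale e₀ n)))
      (hubbardInteraction L M β U + counterQuadratic L M β K₁))) :
    klEffectiveAction L M β U μ K₂ e₀ n =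
      effAction ℂ (normalCovariance L M (uvSymbolCT L M β μ K₂ (klScale e₀ n))) (counterQuadratic L M β (fsub K₂ K₁)) +
        ExteriorAlgebra.map (LinearMap.mulLeft ℂ fun X : HubbardFieldIdx L M =>
            (1 + uvSymbolCT L M β μ K₂ (klScale e₀ n) X.1 *
              (((fsub K₂ K₁).eval (latticeMomentum L X.1.1.2) / (β * (L : ℝ) ^ 2) : ℝ) : ℂ))⁻¹)
          (klEffectiveAction L M β U μ K₁ e₀ n) := by
  have hZ₂ : effPartitionFn ℂ (normalCovariance L M (uvSymbolCT L M β μ K₂ (klScale e₀ n)))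
      (hubbardInteraction L M β U + counterQuadratic L M β K₂) ≠ 0 :=
    ((isUnit_effPartitionFn_frame_iff_of_scale_le_pi_div hβ U μ K₁ K₂ e₀ n hΛ hΛβ).2 hZ₁).ne_zero
  have hT₁ : klEffectiveAction L M β U μ K₁ e₀ n =
      effAction ℂ (normalCovariance L M (uvSymbolCT L M β μ K₁ (klScale e₀ n))) (hubbardInteraction L M β U + counterQuadratic L M β K₁) := by
    rw [klEffectiveAction, hubbardEffectiveActionCT_def, hubbardInteractionCT, hubbardCovAboveCT_zero_seed_eq_normalCovariance_uvSymbolCT]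
  have hc0 : constPart ℂ (klEffectiveAction L M β U μ K₁ e₀ n) = 0 := by
    rw [hT₁]; exact constPart_effAction ℂ _ _ hZ₁
  rw [klEffectiveAction_eq_chain_add_map_nearIdentity hβ U μ K₁ K₂ e₀ n hZ₂ hZ₁,
    normalCovariance_mismatchDefect_eq_zero_of_scale_le_pi_div hβ μ K₁ K₂ e₀ n hΛ hΛβ, effAction_zero_cov ℂ _ hc0]

/-! ## §4 The reading: the last-scale self-energies at two frames differ by pure algebra -/

/-- **`Σ^{K₂}(k,σ) = βL²κ_D − βL²κ_D²·Ψ̃(k,σ) + (1 − κ_D·Ψ̃(k,σ))²·Σ^{K₁}(k,σ)` EXACTLY below temperature** (FST's counterterm chain and external-leg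
dressing, with the near-identity response term of p549694 §5 replaced by `Σ^{K₁}` itself since `d = 0`). [cite: FeldmanSalmhoferTrubowitz1996, §1] -/
theorem klSelfEnergy_frame_eq_dressed_of_scale_le_pi_div [NeZero M]
    (hZ₁ : IsUnit (effPartitionFn ℂ (normalCovariance L M (uvSymbolCT L M β μ K₁ (klScale e₀ n)))
      (hubbardInteraction L M β U + counterQuadratic L M β K₁)))
    (k : FreqMomentum L M) (σ : Fin 2) :
    klSelfEnergy L M β U μ K₂ e₀ n k σ =
      ((β * (L : ℝ) ^ 2 : ℝ) : ℂ) * (((fsub K₂ K₁).eval (latticeMomentum L k.2) / (β * (L : ℝ) ^ 2) : ℝ) : ℂ) -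
        ((β * (L : ℝ) ^ 2 : ℝ) : ℂ) * (((fsub K₂ K₁).eval (latticeMomentum L k.2) / (β * (L : ℝ) ^ 2) : ℝ) : ℂ) ^ 2 *
          (uvSymbolCT L M β μ K₂ (klScale e₀ n) (k, σ) /
            (1 + uvSymbolCT L M β μ K₂ (klScale e₀ n) (k, σ) * (((fsub K₂ K₁).eval (latticeMomentum L k.2) / (β * (L : ℝ) ^ 2) : ℝ) : ℂ))) +
        (1 - (((fsub K₂ K₁).eval (latticeMomentum L k.2) / (β * (L : ℝ) ^ 2) : ℝ) : ℂ) *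
            (uvSymbolCT L M β μ K₂ (klScale e₀ n) (k, σ) /
              (1 + uvSymbolCT L M β μ K₂ (klScale e₀ n) (k, σ) * (((fsub K₂ K₁).eval (latticeMomentum L k.2) / (β * (L : ℝ) ^ 2) : ℝ) : ℂ)))) ^ 2 *
          klSelfEnergy L M β U μ K₁ e₀ n k σ := by
  have hZ₂ : IsUnit (effPartitionFn ℂ (normalCovariance L M (uvSymbolCT L M β μ K₂ (klScale e₀ n)))
      (hubbardInteraction L M β U + counterQuadratic L M β K₂)) :=
    (isUnit_effPartitionFn_frame_iff_of_scale_le_pi_div hβ U μ K₁ K₂ e₀ n hΛ hΛβ).2 hZ₁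
  have hT₁ : klEffectiveAction L M β U μ K₁ e₀ n =
      effAction ℂ (normalCovariance L M (uvSymbolCT L M β μ K₁ (klScale e₀ n))) (hubbardInteraction L M β U + counterQuadratic L M β K₁) := by
    rw [klEffectiveAction, hubbardEffectiveActionCT_def, hubbardInteractionCT, hubbardCovAboveCT_zero_seed_eq_normalCovariance_uvSymbolCT]
  have hc0 : constPart ℂ (klEffectiveAction L M β U μ K₁ e₀ n) = 0 := by
    rw [hT₁]; exact constPart_effAction ℂ _ _ hZ₁
  rw [klSelfEnergy_frame_eq_chain_add_dressed hβ U μ K₁ K₂ e₀ n hZ₂ hZ₁ k σ,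
    normalCovariance_mismatchDefect_eq_zero_of_scale_le_pi_div hβ μ K₁ K₂ e₀ n hΛ hΛβ, effAction_zero_cov ℂ _ hc0]
  rfl

end BelowTemperature

/-! ### The dressing factor is `O(|D|·β)` at ANY scale -/

section Dressing

variable {β : ℝ} (hβ : 0 < β) (μ : ℝ) (K₁ K₂ : TrigPolyC4v) (Λ : ℝ)
include hβ

/-- **The dressing ratio is small with the mismatch**: `‖κ_D(k)·Ψ̃(k,σ)‖ ≤ |D(p_k⃗)|·(β/π)` at EVERY scale — with `z = −iω + e_{K₂}(k⃗)` and the cutoff weight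
`w ∈ [0,1]`, `κ_DΨ̃ = wD/(z + wD)` and `|Im(z + wD)| = |ω| ≥ π/β`. [cite: FeldmanSalmhoferTrubowitz1996, §1] -/
theorem norm_frameDressing_le (i : MatsubaraIdx M) (kv : TorusSite 2 L) (σ : Fin 2) :
    ‖(((fsub K₂ K₁).eval (latticeMomentum L kv) / (β * (L : ℝ) ^ 2) : ℝ) : ℂ) *
        (uvSymbolCT L M β μ K₂ Λ ((i, kv), σ) /
          (1 + uvSymbolCT L M β μ K₂ Λ ((i, kv), σ) * (((fsub K₂ K₁).eval (latticeMomentum L kv) / (β * (L : ℝ) ^ 2) : ℝ) : ℂ)))‖ ≤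
      |(fsub K₂ K₁).eval (latticeMomentum L kv)| * (β / Real.pi) := by
  have hL : (0 : ℝ) < L := by exact_mod_cast NeZero.pos L
  set D : ℝ := (fsub K₂ K₁).eval (latticeMomentum L kv) with hDdef
  set ω : ℝ := matsubaraFreq β M i with hωdef
  set w : ℝ := hubbardCutoffWeightCT L M β μ K₂ Λ (i, kv) with hwdef
  have hν : ω ≠ 0 := matsubaraFreq_ne_zero hβ.ne' i
  have hβL0 : (0 : ℝ) < β * (L : ℝ) ^ 2 := by positivity
  have hβL : ((β * (L : ℝ) ^ 2 : ℝ) : ℂ) ≠ 0 := by exact_mod_cast hβL0.ne'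
  set z : ℂ := -((ω : ℝ) : ℂ) * Complex.I + (nambuXiCT L μ K₂ kv : ℂ) with hzdef
  have hz : z ≠ 0 := neg_ofReal_mul_I_add_ne_zero hν (nambuXiCT L μ K₂ kv)
  have hzD : z + (w : ℂ) * (D : ℂ) ≠ 0 := neg_ofReal_mul_I_add_add_ne_zero hν _ _ _
  have hΨ : uvSymbolCT L M β μ K₂ Λ ((i, kv), σ) = ((β * (L : ℝ) ^ 2 : ℝ) : ℂ) * ((w : ℂ) / z) := by
    rw [← uvSymbolCT_div_eq hβ μ K₂ Λ i kv σ]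
    field_simp
  have hκ : ((D / (β * (L : ℝ) ^ 2) : ℝ) : ℂ) = (D : ℂ) / ((β * (L : ℝ) ^ 2 : ℝ) : ℂ) := by
    push_cast
    rfl
  -- the ratio in closed form
  have hr : ((D / (β * (L : ℝ) ^ 2) : ℝ) : ℂ) *
      (uvSymbolCT L M β μ K₂ Λ ((i, kv), σ) /
        (1 + uvSymbolCT L M β μ K₂ Λ ((i, kv), σ) * ((D / (β * (L : ℝ) ^ 2) : ℝ) : ℂ))) =
      (w : ℂ) * (D : ℂ) / (z + (w : ℂ) * (D : ℂ)) := by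
    have h1 : 1 + uvSymbolCT L M β μ K₂ Λ ((i, kv), σ) * ((D / (β * (L : ℝ) ^ 2) : ℝ) : ℂ) = (z + (w : ℂ) * (D : ℂ)) / z := by
      rw [hΨ, hκ]
      field_simp
    rw [h1, hΨ, hκ]
    field_simp
  rw [hr, norm_div, norm_mul, Complex.norm_real, Complex.norm_real]
  -- `|Im(z + wD)| = |ω|`
  have him : |ω| ≤ ‖z + (w : ℂ) * (D : ℂ)‖ := by
    have h := Complex.abs_im_le_norm (z + (w : ℂ) * (D : ℂ))
    have hi : (z + (w : ℂ) * (D : ℂ)).im = -ω := by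
      simp [hzdef]
    rwa [hi, abs_neg] at h
  have hωpos : 0 < |ω| := abs_pos.2 hν
  have hden_pos : 0 < ‖z + (w : ℂ) * (D : ℂ)‖ := hωpos.trans_le him
  have hw : w ∈ Set.Icc (0 : ℝ) 1 := by
    rw [hwdef]; unfold hubbardCutoffWeightCT; exact salmhoferCutoff_mem_Icc _
  have hw1 : ‖w‖ ≤ 1 := by
    rw [Real.norm_eq_abs, abs_of_nonneg hw.1]; exact hw.2
  have hπω : Real.pi / β ≤ |ω| := pi_div_le_abs_matsubaraFreq hβ i
  -- `‖w‖·|D| / ‖z + wD‖ ≤ |D| / |ω| ≤ |D|·β/π`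
  have hstep : ‖w‖ * ‖D‖ / ‖z + (w : ℂ) * (D : ℂ)‖ ≤ ‖D‖ / |ω| := by
    rw [div_le_div_iff₀ hden_pos hωpos]
    calc ‖w‖ * ‖D‖ * |ω| ≤ 1 * ‖D‖ * ‖z + (w : ℂ) * (D : ℂ)‖ := by gcongr
      _ = ‖D‖ * ‖z + (w : ℂ) * (D : ℂ)‖ := by ring
  refine hstep.trans ?_
  rw [Real.norm_eq_abs, div_eq_mul_one_div]
  refine mul_le_mul_of_nonneg_left ?_ (abs_nonneg D)
  -- `1/|ω| ≤ β/π`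
  rw [one_div_le hωpos (by positivity), one_div_div]
  exact hπω

end Dressing

/-! ### The estimate -/

/-- Scalar bookkeeping for the dressing identity: `‖−D·r + (r² − 2r)·S‖ ≤ |D|·ρ + (ρ² + 2ρ)·‖S‖` whenever `‖r‖ ≤ ρ`. -/
theorem norm_neg_mul_add_sq_sub_mul_le {D : ℝ} {r S : ℂ} {ρ : ℝ} (hr : ‖r‖ ≤ ρ) :
    ‖-((D : ℂ) * r) + (r ^ 2 - 2 * r) * S‖ ≤ |D| * ρ + (ρ ^ 2 + 2 * ρ) * ‖S‖ := by
  have hρ : 0 ≤ ρ := (norm_nonneg r).trans hr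
  have h1 : ‖-((D : ℂ) * r)‖ ≤ |D| * ρ := by
    rw [norm_neg, norm_mul (D : ℂ) r, Complex.norm_real, Real.norm_eq_abs]
    exact mul_le_mul_of_nonneg_left hr (abs_nonneg D)
  have h2 : ‖(r ^ 2 - 2 * r) * S‖ ≤ (ρ ^ 2 + 2 * ρ) * ‖S‖ := by
    rw [norm_mul (r ^ 2 - 2 * r) S]
    refine mul_le_mul_of_nonneg_right ?_ (norm_nonneg S)
    calc ‖r ^ 2 - 2 * r‖ ≤ ‖r ^ 2‖ + ‖2 * r‖ := norm_sub_le _ _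
      _ = ‖r‖ ^ 2 + 2 * ‖r‖ := by rw [norm_pow, norm_mul, Complex.norm_two]
      _ ≤ ρ ^ 2 + 2 * ρ := by gcongr
  exact (norm_add_le _ _).trans (add_le_add h1 h2)

section Estimate

variable {β : ℝ} (hβ : 0 < β) (U μ : ℝ) (K₁ K₂ : TrigPolyC4v) (e₀ : ℝ) (n : ℕ)
  (hΛ : 0 < klScale e₀ n) (hΛβ : klScale e₀ n ≤ Real.pi / β)
include hβ hΛ hΛβ

/-- **`‖Σ^{K₂}(k,σ) − Σ^{K₁}(k,σ) − D(p_k⃗)‖ ≤ |D|·(β/π)·(|D| + (2 + |D|·β/π)·‖Σ^{K₁}(k,σ)‖)` below temperature** (`D = D(p_k⃗)`): from §4,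
`Σ^{K₂} − Σ^{K₁} − D = −D·r + (r² − 2r)·Σ^{K₁}` with `r = κ_DΨ̃(k,σ)`, `‖r‖ ≤ |D|β/π`.  No response term, no interpolating partition functions, no four-leg
sup: the frame change of the last-scale carrier of one volume is pure algebra. [cite: FeldmanSalmhoferTrubowitz1996, §1] -/
theorem norm_klSelfEnergy_frame_sub_sub_le_of_scale_le_pi_div [NeZero M]
    (hZ₁ : IsUnit (effPartitionFn ℂ (normalCovariance L M (uvSymbolCT L M β μ K₁ (klScale e₀ n)))
      (hubbardInteraction L M β U + counterQuadratic L M β K₁)))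
    (i : MatsubaraIdx M) (kv : TorusSite 2 L) (σ : Fin 2) :
    ‖klSelfEnergy L M β U μ K₂ e₀ n (i, kv) σ - klSelfEnergy L M β U μ K₁ e₀ n (i, kv) σ -
        ((fsub K₂ K₁).eval (latticeMomentum L kv) : ℂ)‖ ≤
      |(fsub K₂ K₁).eval (latticeMomentum L kv)| * (β / Real.pi) *
        (|(fsub K₂ K₁).eval (latticeMomentum L kv)| +
          (2 + |(fsub K₂ K₁).eval (latticeMomentum L kv)| * (β / Real.pi)) * ‖klSelfEnergy L M β U μ K₁ e₀ n (i, kv) σ‖) := by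
  have hL : (0 : ℝ) < L := by exact_mod_cast NeZero.pos L
  have hβL0 : (0 : ℝ) < β * (L : ℝ) ^ 2 := by positivity
  set D : ℝ := (fsub K₂ K₁).eval (latticeMomentum L kv) with hDdef
  set κ : ℂ := ((D / (β * (L : ℝ) ^ 2) : ℝ) : ℂ) with hκdef
  set Ψt : ℂ := uvSymbolCT L M β μ K₂ (klScale e₀ n) ((i, kv), σ) /
      (1 + uvSymbolCT L M β μ K₂ (klScale e₀ n) ((i, kv), σ) * κ) with hΨtdef
  set r : ℂ := κ * Ψt with hrdef
  set S₁ : ℂ := klSelfEnergy L M β U μ K₁ e₀ n (i, kv) σ with hS₁def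
  have hβ' : (β : ℂ) ≠ 0 := by exact_mod_cast hβ.ne'
  have hL' : (L : ℂ) ≠ 0 := by exact_mod_cast NeZero.ne L
  have hcκ : ((β * (L : ℝ) ^ 2 : ℝ) : ℂ) * κ = (D : ℂ) := by
    rw [hκdef]
    push_cast
    field_simp
  -- the exact reading of §4, regrouped
  have hread := klSelfEnergy_frame_eq_dressed_of_scale_le_pi_div hβ U μ K₁ K₂ e₀ n hΛ hΛβ hZ₁ (i, kv) σ
  have hE : klSelfEnergy L M β U μ K₂ e₀ n (i, kv) σ - S₁ - (D : ℂ) = -((D : ℂ) * r) + (r ^ 2 - 2 * r) * S₁ := by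
    rw [hread, ← hcκ]
    simp only [hrdef, hΨtdef, hκdef, hS₁def, hDdef]
    ring
  have hr : ‖r‖ ≤ |D| * (β / Real.pi) := by
    rw [hrdef, hΨtdef, hκdef, hDdef]
    exact norm_frameDressing_le hβ μ K₁ K₂ (klScale e₀ n) i kv σ
  rw [hE]
  refine (norm_neg_mul_add_sq_sub_mul_le hr).trans (le_of_eq ?_)
  ring

/-- **Hence `‖Σ^{K₂}(k,σ) − Σ^{K₁}(k,σ)‖ ≤ |D| + |D|·(β/π)·(|D| + (2 + |D|·β/π)·‖Σ^{K₁}(k,σ)‖)`** below temperature — the frame-mismatch leg of a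
last-scale two-volume comparison, from the mismatch `|D(p_k⃗)|` and a one-volume bound on `Σ^{K₁}` alone. [cite: FeldmanSalmhoferTrubowitz1996, §1] -/
theorem norm_klSelfEnergy_frame_sub_le_of_scale_le_pi_div [NeZero M]
    (hZ₁ : IsUnit (effPartitionFn ℂ (normalCovariance L M (uvSymbolCT L M β μ K₁ (klScale e₀ n)))
      (hubbardInteraction L M β U + counterQuadratic L M β K₁)))
    (i : MatsubaraIdx M) (kv : TorusSite 2 L) (σ : Fin 2) :
    ‖klSelfEnergy L M β U μ K₂ e₀ n (i, kv) σ - klSelfEnergy L M β U μ K₁ e₀ n (i, kv) σ‖ ≤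
      |(fsub K₂ K₁).eval (latticeMomentum L kv)| +
        |(fsub K₂ K₁).eval (latticeMomentum L kv)| * (β / Real.pi) *
          (|(fsub K₂ K₁).eval (latticeMomentum L kv)| +
            (2 + |(fsub K₂ K₁).eval (latticeMomentum L kv)| * (β / Real.pi)) * ‖klSelfEnergy L M β U μ K₁ e₀ n (i, kv) σ‖) := by
  have h := norm_klSelfEnergy_frame_sub_sub_le_of_scale_le_pi_div hβ U μ K₁ K₂ e₀ n hΛ hΛβ hZ₁ i kv σ
  have hsplit : klSelfEnergy L M β U μ K₂ e₀ n (i, kv) σ - klSelfEnergy L M β U μ K₁ e₀ n (i, kv) σ =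
      ((fsub K₂ K₁).eval (latticeMomentum L kv) : ℂ) +
        (klSelfEnergy L M β U μ K₂ e₀ n (i, kv) σ - klSelfEnergy L M β U μ K₁ e₀ n (i, kv) σ -
          ((fsub K₂ K₁).eval (latticeMomentum L kv) : ℂ)) := by ring
  rw [hsplit]
  refine (norm_add_le _ _).trans ?_
  rw [Complex.norm_real, Real.norm_eq_abs]
  gcongr

end Estimate

/-! ## §5 At the VL reading scale of the KL regime (`e₀ = klE0`, `n = nScales β + 1`): only `0 < β` is needed -/

section LastScale

variable {β : ℝ} (hβ : 0 < β) (U μ : ℝ) (K₁ K₂ : TrigPolyC4v)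
include hβ

omit hβ in
/-- `0 < Λ_{n_β+1}`. -/
theorem klScale_nScales_succ_pos : 0 < klScale klE0 (nScales β + 1) := by
  unfold klScale klE0
  positivity

/-- **At the VL reading scale the undressed partition function is a unit at one frame iff at the other.** [cite: BenfattoGiulianiMastropietro2006, §2.3 (2.24)] -/
theorem isUnit_effPartitionFn_frame_iff_lastScale [NeZero M] :
    IsUnit (effPartitionFn ℂ (normalCovariance L M (uvSymbolCT L M β μ K₂ (klScale klE0 (nScales β + 1))))
        (hubbardInteraction L M β U + counterQuadratic L M β K₂)) ↔
      IsUnit (effPartitionFn ℂ (normalCovariance L M (uvSymbolCT L M β μ K₁ (klScale klE0 (nScales β + 1))))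
        (hubbardInteraction L M β U + counterQuadratic L M β K₁)) :=
  isUnit_effPartitionFn_frame_iff_of_scale_le_pi_div hβ U μ K₁ K₂ klE0 (nScales β + 1) klScale_nScales_succ_pos
    (klScale_nScales_succ_lt hβ).le

/-- **At the VL reading scale the one-shot actions of one volume at two frames differ EXACTLY by the mismatch chain and the external-leg dressing**:
`T(K₂) = effAction (normalCovariance Ψ_{K₂}) 𝒩_{K₂⊖K₁} + S_m·T(K₁)`. [cite: BenfattoGiulianiMastropietro2006, §2.3 (2.21)–(2.24)] -/
theorem klEffectiveAction_frame_eq_chain_add_map_lastScale [NeZero M]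
    (hZ₁ : IsUnit (effPartitionFn ℂ (normalCovariance L M (uvSymbolCT L M β μ K₁ (klScale klE0 (nScales β + 1))))
      (hubbardInteraction L M β U + counterQuadratic L M β K₁))) :
    klEffectiveAction L M β U μ K₂ klE0 (nScales β + 1) =
      effAction ℂ (normalCovariance L M (uvSymbolCT L M β μ K₂ (klScale klE0 (nScales β + 1)))) (counterQuadratic L M β (fsub K₂ K₁)) +
        ExteriorAlgebra.map (LinearMap.mulLeft ℂ fun X : HubbardFieldIdx L M =>
            (1 + uvSymbolCT L M β μ K₂ (klScale klE0 (nScales β + 1)) X.1 *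
              (((fsub K₂ K₁).eval (latticeMomentum L X.1.1.2) / (β * (L : ℝ) ^ 2) : ℝ) : ℂ))⁻¹)
          (klEffectiveAction L M β U μ K₁ klE0 (nScales β + 1)) :=
  klEffectiveAction_frame_eq_chain_add_map_of_scale_le_pi_div hβ U μ K₁ K₂ klE0 (nScales β + 1) klScale_nScales_succ_pos
    (klScale_nScales_succ_lt hβ).le hZ₁

/-- **At the VL reading scale: `‖Σ^{K₂}(k,σ) − Σ^{K₁}(k,σ)‖ ≤ |D| + |D|·(β/π)·(|D| + (2 + |D|·β/π)·‖Σ^{K₁}(k,σ)‖)`**, `D = (K₂ ⊖ K₁)(p_k⃗)` — leg (ii) of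
the triangle door of 20440 from the mismatch and a one-volume bound alone. [cite: FeldmanSalmhoferTrubowitz1996, §1] -/
theorem norm_klSelfEnergy_frame_sub_le_lastScale [NeZero M]
    (hZ₁ : IsUnit (effPartitionFn ℂ (normalCovariance L M (uvSymbolCT L M β μ K₁ (klScale klE0 (nScales β + 1))))
      (hubbardInteraction L M β U + counterQuadratic L M β K₁)))
    (i : MatsubaraIdx M) (kv : TorusSite 2 L) (σ : Fin 2) :
    ‖klSelfEnergy L M β U μ K₂ klE0 (nScales β + 1) (i, kv) σ - klSelfEnergy L M β U μ K₁ klE0 (nScales β + 1) (i, kv) σ‖ ≤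
      |(fsub K₂ K₁).eval (latticeMomentum L kv)| +
        |(fsub K₂ K₁).eval (latticeMomentum L kv)| * (β / Real.pi) *
          (|(fsub K₂ K₁).eval (latticeMomentum L kv)| +
            (2 + |(fsub K₂ K₁).eval (latticeMomentum L kv)| * (β / Real.pi)) *
              ‖klSelfEnergy L M β U μ K₁ klE0 (nScales β + 1) (i, kv) σ‖) :=
  norm_klSelfEnergy_frame_sub_le_of_scale_le_pi_div hβ U μ K₁ K₂ klE0 (nScales β + 1) klScale_nScales_succ_pos
    (klScale_nScales_succ_lt hβ).le hZ₁ i kv σ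

end LastScale

end Summit.HubbardSuperconductivity.HubbardSuperconductivity.Theorems.TwoVolumeDefect

end
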